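import Summits.Ventures.PercRepro.C026CutVertex
import Summits.Ventures.PercRepro.C026AddEdge

/-!
# A mark-free two-terminal gadget: the virtual-edge dictionary (p5, gen 15)

mine-3 (`proofs/MINE3-TWOCUT.md`, INBOX 18:46Z, Theorem C′ / B″): a gadget `Γ` glued to `G₁` at the two
terminals `s, t` (p6's gluing with terminals `(s, t, t)`: every other vertex carries one colour; the gadget is
the side `false`) acts on the side `true` like a VIRTUAL EDGE `st` that is open iff the gadget joins `s` to `t`:
for `x, y` on side `true` (or terminals), `x ~_G y` iff `x ~ y` in `G₁ + st` (C026AddEdge) with the new edge in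
the state `[s ~_Γ t]` (`conn_twocut_iff`); the closed connectivity factors the same way with the state
`[s ~_{Γ̄} t]` (`conn_compl_twocut_iff`).
-/

namespace PercRepro

open Finset

namespace MultiGraph

section TwoCut

variable {V E : Type*} {G : MultiGraph V E}

open Classical in
/-- The gadget's open join of the terminals, as a Boolean, on the gadget's own cube. -/
noncomputable def gadgetJoin₂ (G : MultiGraph V E) (side : E → Bool) (s t : V)
    (ω₂ : Config {e // side e = false}) : Bool :=
  decide ((G.part side false).Conn ω₂ s t)

/-- The gadget's open join of the terminals at a configuration of `G`. -/
noncomputable def gadgetJoin (G : MultiGraph V E) (side : E → Bool) (s t : V) (ω : Config E) : Bool :=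
  G.gadgetJoin₂ side s t (sideRestrict ω side false)

open Classical in
/-- `gadgetJoin₂ = true` iff the gadget joins `s` to `t`. -/
theorem gadgetJoin₂_eq_true_iff (side : E → Bool) (s t : V) (ω₂ : Config {e // side e = false}) :
    G.gadgetJoin₂ side s t ω₂ = true ↔ (G.part side false).Conn ω₂ s t := by
  unfold gadgetJoin₂
  exact decide_eq_true_iff

open Classical in
/-- `gadgetJoin₂ = false` iff the gadget does not join `s` to `t`. -/
theorem gadgetJoin₂_eq_false_iff (side : E → Bool) (s t : V) (ω₂ : Config {e // side e = false}) :
    G.gadgetJoin₂ side s t ω₂ = false ↔ ¬ (G.part side false).Conn ω₂ s t := by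
  unfold gadgetJoin₂
  exact decide_eq_false_iff_not

/-- `gadgetJoin = true` iff the gadget joins `s` to `t`. -/
theorem gadgetJoin_eq_true_iff (side : E → Bool) (s t : V) (ω : Config E) :
    G.gadgetJoin side s t ω = true ↔ (G.part side false).Conn (sideRestrict ω side false) s t :=
  gadgetJoin₂_eq_true_iff side s t _

/-- The join at the complement is the join of the complemented restriction. -/
theorem gadgetJoin_compl (side : E → Bool) (s t : V) (ω : Config E) :
    G.gadgetJoin side s t ωᶜ = G.gadgetJoin₂ side s t (sideRestrict ω side false)ᶜ := by
  unfold gadgetJoin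
  rw [sideRestrict_compl]

/-- The virtual-edge graph: `G₁ + st`. -/
noncomputable abbrev virt (G : MultiGraph V E) (side : E → Bool) (s t : V) :
    MultiGraph V (Option {e // side e = true}) :=
  (G.part side true).addEdge s t

/-- A step of `G₁` is a step of the virtual-edge graph (any state of the virtual edge). -/
theorem conn_virt_of_conn_part {side : E → Bool} {s t : V} {b : Bool} {ω : Config E} {x y : V}
    (h : (G.part side true).Conn (sideRestrict ω side true) x y) :
    (G.virt side s t).Conn (extendOpt b (sideRestrict ω side true)) x y :=
  conn_addEdge_of_conn h

/-- **The virtual-edge dictionary (open)**: for `x, y` on side `true` or terminals, `x ~_G y` iff `x ~ y` in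
`G₁ + st` with the virtual edge open iff the gadget joins `s` to `t`. -/
theorem conn_twocut_iff {s t : V} {side : E → Bool} (hg : G.IsGluing s t t side) {x y : V}
    (hx : x = s ∨ x = t ∨ G.OnSide side true x) (hy : y = s ∨ y = t ∨ G.OnSide side true y)
    (ω : Config E) :
    G.Conn ω x y ↔
      (G.virt side s t).Conn (extendOpt (G.gadgetJoin side s t ω) (sideRestrict ω side true)) x y := by
  set b := G.gadgetJoin side s t ω with hb
  have hbt : b = true ↔ (G.part side false).Conn (sideRestrict ω side false) s t :=
    gadgetJoin_eq_true_iff side s t ω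
  -- a terminal-to-terminal crossing of the gadget is the open virtual edge
  have hvirt : ∀ {p q : V}, (p = s ∧ q = t) ∨ (p = t ∧ q = s) →
      (G.part side false).Conn (sideRestrict ω side false) p q →
      (G.virt side s t).Conn (extendOpt b (sideRestrict ω side true)) p q := by
    intro p q hpq hc
    have hst : (G.part side false).Conn (sideRestrict ω side false) s t := by
      rcases hpq with ⟨hp, hq⟩ | ⟨hp, hq⟩
      · rw [← hp, ← hq]; exact hc
      · rw [← hp, ← hq]; exact hc.symm
    have hb' : b = true := hbt.mpr hst
    have hadj : (G.virt side s t).OpenAdj (extendOpt b (sideRestrict ω side true)) s t :=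
      ⟨none, by rw [extendOpt_none, hb'], Or.inl ⟨rfl, rfl⟩⟩
    rcases hpq with ⟨hp, hq⟩ | ⟨hp, hq⟩
    · rw [hp, hq]; exact Conn.of_openAdj hadj
    · rw [hp, hq]; exact Conn.of_openAdj hadj.symm
  constructor
  · intro h
    -- invariant: reached on side `true` (virtual connectivity), or inside the gadget through `s` or `t`
    suffices key : (G.virt side s t).Conn (extendOpt b (sideRestrict ω side true)) x y ∨
        ((G.virt side s t).Conn (extendOpt b (sideRestrict ω side true)) x s ∧
          (G.part side false).Conn (sideRestrict ω side false) s y) ∨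
        ((G.virt side s t).Conn (extendOpt b (sideRestrict ω side true)) x t ∧
          (G.part side false).Conn (sideRestrict ω side false) t y) by
      rcases key with key | ⟨hxs, hsy⟩ | ⟨hxt, hty⟩
      · exact key
      · -- `y` is reached through `s`: it is `s`, or `t` (then the gadget joins `s` to `t`)
        by_cases hys : y = s
        · rw [hys]; exact hxs
        · by_cases hyt : y = t
          · rw [hyt] at hsy ⊢
            exact hxs.trans (hvirt (Or.inl ⟨rfl, rfl⟩) hsy)
          · exfalso
            rcases hy with hy | hy | hy
            · exact hys hy
            · exact hyt hy
            · exact not_hasCol_of_onSide (by decide) hy (hasCol_of_conn_part hsy hys)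
      · by_cases hyt : y = t
        · rw [hyt]; exact hxt
        · by_cases hys : y = s
          · rw [hys] at hty ⊢
            exact hxt.trans (hvirt (Or.inr ⟨rfl, rfl⟩) hty)
          · exfalso
            rcases hy with hy | hy | hy
            · exact hys hy
            · exact hyt hy
            · exact not_hasCol_of_onSide (by decide) hy (hasCol_of_conn_part hty hyt)
    refine Conn.induction
      (motive := fun z => (G.virt side s t).Conn (extendOpt b (sideRestrict ω side true)) x z ∨
        ((G.virt side s t).Conn (extendOpt b (sideRestrict ω side true)) x s ∧
          (G.part side false).Conn (sideRestrict ω side false) s z) ∨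
        ((G.virt side s t).Conn (extendOpt b (sideRestrict ω side true)) x t ∧
          (G.part side false).Conn (sideRestrict ω side false) t z))
      (Or.inl (Conn.refl _ _ x)) ?_ h
    intro z z' _ hzz' ih
    obtain ⟨e, he, hend⟩ := hzz'
    have hj : G.Joins e z z' := hend
    -- a vertex carrying an edge of colour `true` reached through the gadget is a terminal
    have hterm : ∀ {p : V}, (p = s ∨ p = t) → side e = true →
        (G.part side false).Conn (sideRestrict ω side false) p z → z = s ∨ z = t := by
      intro p hp hse hpz
      by_contra hz
      push Not at hz
      by_cases hzp : z = p
      · rcases hp with hp | hp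
        · exact hz.1 (hzp.trans hp)
        · exact hz.2 (hzp.trans hp)
      · have h1 : G.HasCol side false z := hasCol_of_conn_part hpz hzp
        have h2 : G.HasCol side true z := ⟨e, hse, EdgeAt.of_joins_left hj⟩
        exact Bool.false_ne_true (hg.eq_of_hasCol hz.1 hz.2 hz.2 h1 h2)
    -- a vertex carrying an edge of colour `false` reached on side `true` is a terminal
    have hterm' : side e = false →
        (G.virt side s t).Conn (extendOpt b (sideRestrict ω side true)) x z → z = s ∨ z = t := by
      intro hse _
      by_contra hz
      push Not at hz
      have h2 : G.HasCol side false z := ⟨e, hse, EdgeAt.of_joins_left hj⟩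
      -- `z` is on side `true` (it is `x`, or reached by a side-`true` walk), so it has colour `true`
      have h1 : G.HasCol side true z := by
        by_cases hzx : z = x
        · subst hzx
          rcases hx with hx | hx | hx
          · exact absurd hx hz.1
          · exact absurd hx hz.2
          · exact ⟨e, hx e (EdgeAt.of_joins_left hj), EdgeAt.of_joins_left hj⟩
        · -- a nontrivial walk of `G₁ + st` ending at the non-terminal `z` ends with an edge of `G₁`
          rename_i hxz
          rcases Relation.ReflTransGen.cases_tail hxz with hxz | ⟨w, _, hwz⟩
          · exact absurd hxz hzx
          · obtain ⟨e', he', hend'⟩ := hwz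
            cases e' with
            | none =>
              exfalso
              simp only [addEdge_fst_none, addEdge_snd_none] at hend'
              rcases hend' with ⟨_, h2'⟩ | ⟨h1', _⟩
              · exact hz.2 h2'.symm
              · exact hz.1 h1'.symm
            | some e' =>
              simp only [addEdge_fst_some, addEdge_snd_some, part_fst, part_snd] at hend'
              exact ⟨e'.1, e'.2, EdgeAt.of_joins_right hend'⟩
      exact Bool.false_ne_true (hg.eq_of_hasCol hz.1 hz.2 hz.2 h2 h1)
    by_cases hse : side e = true
    · -- an edge of `G₁`
      have hstep : (G.virt side s t).OpenAdj (extendOpt b (sideRestrict ω side true)) z z' :=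
        ⟨some ⟨e, hse⟩, he, hj⟩
      rcases ih with hxz | ⟨hxs, hsz⟩ | ⟨hxt, htz⟩
      · exact Or.inl (hxz.tail hstep)
      · rcases hterm (Or.inl rfl) hse hsz with hzs | hzt
        · rw [hzs] at hstep
          exact Or.inl (hxs.tail hstep)
        · rw [hzt] at hsz hstep
          exact Or.inl ((hxs.trans (hvirt (Or.inl ⟨rfl, rfl⟩) hsz)).tail hstep)
      · rcases hterm (Or.inr rfl) hse htz with hzs | hzt
        · rw [hzs] at htz hstep
          exact Or.inl ((hxt.trans (hvirt (Or.inr ⟨rfl, rfl⟩) htz)).tail hstep)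
        · rw [hzt] at hstep
          exact Or.inl (hxt.tail hstep)
    · -- an edge of the gadget
      have hse' : side e = false := bool_eq_of_ne_of_ne (by decide) hse
      have hstep : (G.part side false).OpenAdj (sideRestrict ω side false) z z' :=
        ⟨⟨e, hse'⟩, he, hj⟩
      rcases ih with hxz | ⟨hxs, hsz⟩ | ⟨hxt, htz⟩
      · rcases hterm' hse' hxz with hzs | hzt
        · rw [hzs] at hxz hstep
          exact Or.inr (Or.inl ⟨hxz, Conn.of_openAdj hstep⟩)
        · rw [hzt] at hxz hstep
          exact Or.inr (Or.inr ⟨hxz, Conn.of_openAdj hstep⟩)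
      · exact Or.inr (Or.inl ⟨hxs, hsz.tail hstep⟩)
      · exact Or.inr (Or.inr ⟨hxt, htz.tail hstep⟩)
  · intro h
    refine Conn.induction (motive := fun z => G.Conn ω x z) (Conn.refl G ω x) ?_ h
    intro z z' _ hzz' ih
    obtain ⟨e, he, hend⟩ := hzz'
    cases e with
    | none =>
      -- the virtual edge is open: the gadget joins `s` to `t`
      have hb' : b = true := by simpa using he
      have hst : G.Conn ω s t := Conn.of_part (hbt.mp hb')
      simp only [addEdge_fst_none, addEdge_snd_none] at hend
      rcases hend with ⟨h1, h2⟩ | ⟨h1, h2⟩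
      · subst h1; subst h2; exact ih.trans hst
      · subst h1; subst h2; exact ih.trans hst.symm
    | some e =>
      simp only [addEdge_fst_some, addEdge_snd_some, part_fst, part_snd] at hend
      exact ih.tail ⟨e.1, he, hend⟩

end TwoCut

end MultiGraph

end PercRepro
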